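import Mathlib
import Summits.Ventures.HodgeRepro2.T5WedgeRank

/-!
# T5LiftInvariance — the pulled-back coordinate covectors do not depend on the local lifts

Tier-5 support for sub-step N1 (Hodge-theoretic side; memo route/T5-N1-hodge-p6.md §H6):
«write `e_{a,σ} = dz_a` for the linear coordinates `z_a` on the universal cover `ℂ^{T_a}` of `A_a`
… then `ω_{ab}|_{S_j} = d(z_a ∘ f̃_a) ∧ d(z_b ∘ f̃_b)` for local lifts `f̃_a, f̃_b` to the universal
covers».  This file records, at the chart level, why the right-hand side is well defined:

* `fderiv_clm_comp_eq`: for a continuous linear coordinate `ℓ : E →L[ℂ] ℂ` on the universal cover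
  `E` and a lift `f : G → E` differentiable at `x`, `d(ℓ ∘ f)_x = ℓ ∘ df_x` (chain rule);
* `fderiv_clm_comp_add_const`: translating the lift by a constant `c ∈ E` (a period of the
  lattice) leaves `d(ℓ ∘ f)_x` unchanged — the translation invariance of `dz_a`;
* `exists_eq_add_const_of_sub_mem`: two continuous lifts of the same map on a preconnected set `U`
  (their difference takes values in a discrete set `Λ`, the period lattice) differ by ONE constant
  `c ∈ Λ` on `U`;
* `fderiv_clm_comp_eq_of_lifts` / `fderiv_eq_of_lifts`: hence, on an open preconnected chart, the
  covector field `d(ℓ ∘ f̃)` and the differential `df̃` are the same for every choice of lift;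
* `wedge10_eq_of_lifts`: the coefficient of `d(ℓ_a ∘ f̃_a) ∧ d(ℓ_b ∘ f̃_b)` on a chart `ℂ²`
  (the `wedge10` of `T5WedgeRank`, i.e. the `2 × 2` minor of `T5PullbackRows`) is lift-independent;
* `isDiscrete_zspan`: the ℤ-span of a real basis of `E` (the period lattice of a complex torus)
  is a discrete set, so the hypothesis on `Λ` holds for `ℂ^{T_a} / Λ_a = A_a`.

Blind lane (cell pub-hodge-repro2): `import Mathlib` + own `T5WedgeRank`, 0 sorry, standard axioms.
-/

namespace Summit.Ventures.HodgeRepro2.T5LiftInvariance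

open Filter Topology Set
open Summit.Ventures.HodgeRepro2.T5WedgeRank

variable {G : Type*} [NormedAddCommGroup G] [NormedSpace ℂ G]
variable {E : Type*} [NormedAddCommGroup E] [NormedSpace ℂ E]

/-- Chain rule for a continuous linear coordinate `ℓ` on the universal cover: the pull-back of the
translation-invariant 1-form `dℓ = ℓ` by a lift `f` differentiable at `x` is `ℓ ∘ df_x`. -/
theorem fderiv_clm_comp_eq (ℓ : E →L[ℂ] ℂ) {f : G → E} {x : G} (hf : DifferentiableAt ℂ f x) :
    fderiv ℂ (fun y => ℓ (f y)) x = ℓ.comp (fderiv ℂ f x) :=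
  (ℓ.hasFDerivAt.comp x hf.hasFDerivAt).fderiv

/-- Translating a lift by a constant `c` (e.g. a period) does not change the pulled-back
coordinate covector: `d(ℓ ∘ (f + c))_x = d(ℓ ∘ f)_x`. -/
theorem fderiv_clm_comp_add_const (ℓ : E →L[ℂ] ℂ) (f : G → E) (c : E) (x : G) :
    fderiv ℂ (fun y => ℓ (f y + c)) x = fderiv ℂ (fun y => ℓ (f y)) x := by
  simp only [map_add]
  exact fderiv_add_const (ℓ c)

/-- Translating a lift by a constant does not change its differential. -/
theorem fderiv_add_const_eq (f : G → E) (c : E) (x : G) :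
    fderiv ℂ (fun y => f y + c) x = fderiv ℂ f x :=
  fderiv_add_const c

omit [NormedSpace ℂ G] [NormedSpace ℂ E] in
/-- Two continuous maps on a preconnected set whose difference takes values in a discrete set `Λ`
differ by a single constant `c ∈ Λ` on that set — two local lifts of the same map to the torus
`E / Λ` differ by one period. -/
theorem exists_eq_add_const_of_sub_mem {Λ : Set E} (hΛ : IsDiscrete Λ) {U : Set G}
    (hU : IsPreconnected U) {f f' : G → E} (hf : ContinuousOn f U) (hf' : ContinuousOn f' U)
    (h : ∀ x ∈ U, f x - f' x ∈ Λ) {x₀ : G} (hx₀ : x₀ ∈ U) :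
    ∃ c ∈ Λ, ∀ x ∈ U, f x = f' x + c := by
  refine ⟨f x₀ - f' x₀, h x₀ hx₀, fun x hx => ?_⟩
  have hconst : f x - f' x = f x₀ - f' x₀ :=
    hU.constant_of_mapsTo hΛ (f := fun y => f y - f' y) (hf.sub hf') (fun y hy => h y hy) hx hx₀
  rw [← hconst]
  abel

/-- On an open preconnected chart, the pulled-back coordinate covector field `d(ℓ ∘ f̃)` is the
same for any two lifts `f̃, f̃'` (continuous on the chart, differing pointwise by elements of the
discrete set `Λ`). -/
theorem fderiv_clm_comp_eq_of_lifts (ℓ : E →L[ℂ] ℂ) {Λ : Set E} (hΛ : IsDiscrete Λ) {U : Set G}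
    (hUo : IsOpen U) (hU : IsPreconnected U) {f f' : G → E} (hf : ContinuousOn f U)
    (hf' : ContinuousOn f' U) (h : ∀ x ∈ U, f x - f' x ∈ Λ) {x : G} (hx : x ∈ U) :
    fderiv ℂ (fun y => ℓ (f y)) x = fderiv ℂ (fun y => ℓ (f' y)) x := by
  obtain ⟨c, -, hc⟩ := exists_eq_add_const_of_sub_mem hΛ hU hf hf' h hx
  have hev : (fun y => ℓ (f y)) =ᶠ[𝓝 x] fun y => ℓ (f' y + c) := by
    filter_upwards [hUo.mem_nhds hx] with y hy
    rw [hc y hy]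
  rw [hev.fderiv_eq, fderiv_clm_comp_add_const]

/-- On an open preconnected chart, the differential `df̃` itself is the same for any two lifts. -/
theorem fderiv_eq_of_lifts {Λ : Set E} (hΛ : IsDiscrete Λ) {U : Set G} (hUo : IsOpen U)
    (hU : IsPreconnected U) {f f' : G → E} (hf : ContinuousOn f U) (hf' : ContinuousOn f' U)
    (h : ∀ x ∈ U, f x - f' x ∈ Λ) {x : G} (hx : x ∈ U) :
    fderiv ℂ f x = fderiv ℂ f' x := by
  obtain ⟨c, -, hc⟩ := exists_eq_add_const_of_sub_mem hΛ hU hf hf' h hx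
  have hev : f =ᶠ[𝓝 x] fun y => f' y + c := by
    filter_upwards [hUo.mem_nhds hx] with y hy
    exact hc y hy
  rw [hev.fderiv_eq, fderiv_add_const_eq]

/-- The coefficient of `d(ℓ_a ∘ f̃_a) ∧ d(ℓ_b ∘ f̃_b)` on a chart `ℂ²` — `wedge10` of the two
coefficient vectors `i ↦ d(ℓ ∘ f̃)_x (e_i)` (the rows of the Jacobian of `(ℓ_a ∘ f̃_a, ℓ_b ∘ f̃_b)`,
`T5PullbackRows`) — is the same for any choice of the two lifts: the holomorphic 2-form
`ω_{ab}` of memo H6 is well defined on the surface. -/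
theorem wedge10_eq_of_lifts {Ea Eb : Type*} [NormedAddCommGroup Ea] [NormedSpace ℂ Ea]
    [NormedAddCommGroup Eb] [NormedSpace ℂ Eb] (ℓa : Ea →L[ℂ] ℂ) (ℓb : Eb →L[ℂ] ℂ)
    {Λa : Set Ea} (hΛa : IsDiscrete Λa) {Λb : Set Eb} (hΛb : IsDiscrete Λb)
    {U : Set (Fin 2 → ℂ)} (hUo : IsOpen U) (hU : IsPreconnected U)
    {fa fa' : (Fin 2 → ℂ) → Ea} (hfa : ContinuousOn fa U) (hfa' : ContinuousOn fa' U)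
    (ha : ∀ x ∈ U, fa x - fa' x ∈ Λa)
    {fb fb' : (Fin 2 → ℂ) → Eb} (hfb : ContinuousOn fb U) (hfb' : ContinuousOn fb' U)
    (hb : ∀ x ∈ U, fb x - fb' x ∈ Λb) {x : Fin 2 → ℂ} (hx : x ∈ U) :
    wedge10 (fun i => fderiv ℂ (fun y => ℓa (fa y)) x (Pi.single i 1))
        (fun i => fderiv ℂ (fun y => ℓb (fb y)) x (Pi.single i 1)) =
      wedge10 (fun i => fderiv ℂ (fun y => ℓa (fa' y)) x (Pi.single i 1))
        (fun i => fderiv ℂ (fun y => ℓb (fb' y)) x (Pi.single i 1)) := by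
  rw [fderiv_clm_comp_eq_of_lifts ℓa hΛa hUo hU hfa hfa' ha hx,
    fderiv_clm_comp_eq_of_lifts ℓb hΛb hUo hU hfb hfb' hb hx]

/-- The coefficient of the 2-form is the `2 × 2` minor of the differentials of the lifts
composed with the coordinates: the `wedge10` of the rows `i ↦ ℓ (df̃_x (e_i))`. -/
theorem wedge10_rows_eq_clm_comp {Ea Eb : Type*} [NormedAddCommGroup Ea] [NormedSpace ℂ Ea]
    [NormedAddCommGroup Eb] [NormedSpace ℂ Eb] (ℓa : Ea →L[ℂ] ℂ) (ℓb : Eb →L[ℂ] ℂ)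
    {fa : (Fin 2 → ℂ) → Ea} {fb : (Fin 2 → ℂ) → Eb} {x : Fin 2 → ℂ}
    (hfa : DifferentiableAt ℂ fa x) (hfb : DifferentiableAt ℂ fb x) :
    wedge10 (fun i => fderiv ℂ (fun y => ℓa (fa y)) x (Pi.single i 1))
        (fun i => fderiv ℂ (fun y => ℓb (fb y)) x (Pi.single i 1)) =
      wedge10 (fun i => ℓa (fderiv ℂ fa x (Pi.single i 1)))
        (fun i => ℓb (fderiv ℂ fb x (Pi.single i 1))) := by
  rw [fderiv_clm_comp_eq ℓa hfa, fderiv_clm_comp_eq ℓb hfb]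
  rfl

omit [NormedSpace ℂ E] in
/-- A discrete set is what `exists_eq_add_const_of_sub_mem` needs; a subset with discrete subspace
topology qualifies. -/
theorem isDiscrete_of_discreteTopology (Λ : Set E) [DiscreteTopology Λ] : IsDiscrete Λ :=
  DiscreteTopology.isDiscrete

/-- The period lattice of a complex torus — the ℤ-span of a real basis of the universal cover
(`2g` real periods) — is a discrete subset of `E` (Mathlib's `ZSpan` instance). -/
theorem isDiscrete_zspan {ι : Type*} [Finite ι] (b : Module.Basis ι ℝ E) :
    IsDiscrete ((Submodule.span ℤ (Set.range b) : Submodule ℤ E) : Set E) :=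
  SetLike.isDiscrete_iff_discreteTopology.mpr inferInstance

end Summit.Ventures.HodgeRepro2.T5LiftInvariance
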